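import Mathlib.Algebra.CharZero.Infinite
import Mathlib.LinearAlgebra.Dual.Lemmas
import Mathlib.LinearAlgebra.Finsupp.LinearCombination
import Mathlib.Data.Nat.Choose.Multinomial
import Mathlib.Data.Sym.Card
import Mathlib.Data.Finsupp.Multiset
import Literature.Computability.AlgebraicComplexity.CoefficientSpaceRank
import HarnessLib

/-!
# Proof of the Waring-rank barrier (Efremenko–Garg–Oliveira–Wigderson 2018, Theorem 4.2 / 1.2)

Topic: `Literature/Computability/AlgebraicComplexity`. This file discharges the named facts
`EGOW2018_thm42` (Theorem 4.2: `rank L(f) ≤ r (d+1) · C(n+⌊d/2⌋, n)` for `deg f ≤ d` when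
`rank L(ℓ^d) ≤ r` for all affine `ℓ`) and `EGOW2018_thm12` (Theorem 1.2 / Corollary 4.3) of
`RankMethodBarriers.lean`, following the printed proof (§4.1): for the generic affine form
`ℓ_y = y_0 + ∑ y_i x_i` the matrix `M(y_0, y) = L(ℓ_y^d)` has entries homogeneous of degree `d` in the
`n + 1` variables `y` (multinomial expansion); the engine `rank_sum_smul_eval_le_of_weighted`
(Lemma 3.3 + Cor. 2.11) with the `d + 1` splittings `d = k + (d - k)` and
`#{monomials of degree k in n+1 variables} = C(n+k, n) ≤ C(n+⌊d/2⌋, n)` for `k ≤ ⌊d/2⌋`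
(Prop. 2.10) bounds the rank of every element of `span{L(ℓ^d)}`; finally "the set of all affine
forms of degree `d` span the space of all polynomials of degree at most `d`"
(`mem_span_affinePowers`, characteristic zero: a linear functional vanishing on all `ℓ_b^d`
gives a polynomial in `b` vanishing identically, whose coefficients are non-zero multinomial
multiples of its values on the monomials of degree `≤ d`).

The vendored statement assumes `F` algebraically closed of characteristic zero; the proof uses only
characteristic zero (`EGOW2018_thm42_of_charZero`).

## References

* [EfremenkoGargOliveiraWigderson2018] K. Efremenko, A. Garg, R. Oliveira, A. Wigderson,
  *Barriers for rank methods in arithmetic complexity*, ITCS 2018; arXiv:1710.09502, Prop. 2.10,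
  Cor. 2.11, Lemma 3.3, Def. 4.1, Thm. 4.2, Cor. 4.3 (= Thm. 1.2).
-/

noncomputable section

open MvPolynomial

namespace Literature.Computability.AlgebraicComplexity

section WaringInstance

variable {F : Type*} [Field F] {n d : ℕ}

/-- **Multinomial expansion of a power of a linear combination** (EGOW 2018, proof of Thm. 4.2:
`ℓ(x)^d = d! ∑ … y_0^{e_0} y^e x^e`): `(∑_v b_v q_v)^d = ∑_k (multinomial(k) ∏ b_v^{k_v}) • ∏ q_v^{k_v}`.
[cite: EfremenkoGargOliveiraWigderson2018, Thm. 4.2] -/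
theorem sum_C_mul_pow_eq {σ : Type*} {m : ℕ} (b : Fin m → F) (q : Fin m → MvPolynomial σ F) (d : ℕ) :
    (∑ v, C (b v) * q v) ^ d = ∑ k ∈ (Finset.univ : Finset (Fin m)).piAntidiag d,
      ((Nat.multinomial Finset.univ k : F) * ∏ v, b v ^ k v) • ∏ v, q v ^ k v := by
  classical
  rw [Finset.sum_pow_eq_sum_piAntidiag]
  refine Finset.sum_congr rfl fun k _ => ?_
  simp only [mul_pow, Finset.prod_mul_distrib, ← map_pow, ← map_prod]
  rw [smul_eq_C_mul, map_mul, map_natCast, mul_assoc]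

/-- A monomial is the product of the corresponding powers of the variables. [folklore] -/
theorem monomial_one_eq_prod_X_pow (e : Fin n →₀ ℕ) :
    (monomial e (1 : F)) = ∏ i, (X i : MvPolynomial (Fin n) F) ^ e i := by
  rw [monomial_eq, C_1, one_mul, Finsupp.prod_pow]

/-- The affine form `b_0 + ∑ b_{i+1} x_i` as `∑_v b_v X'_v` with `X' = (1, x_1, …, x_n)`. [cite: EfremenkoGargOliveiraWigderson2018, Thm. 4.2] -/
theorem affineForm_eq_sum_vecCons (b : Fin (n + 1) → F) :
    affineForm (b 0) (fun i => b i.succ) =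
      ∑ v, C (b v) * Matrix.vecCons (1 : MvPolynomial (Fin n) F) (fun i => X i) v := by
  rw [Fin.sum_univ_succ]
  simp [affineForm]

/-- **Monomials of degree `k` in `n + 1` variables number at most `C(n + k, n)`** (EGOW 2018,
Prop. 2.10: `dim 𝒞(f) ≤ C(n+d-1, n-1)` for `n` variables), via the injection into `k`-multisets.
[cite: EfremenkoGargOliveiraWigderson2018, Prop. 2.10] -/
theorem card_finsuppAntidiag_univ_le (k : ℕ) :
    ((Finset.univ : Finset (Fin (n + 1))).finsuppAntidiag k).card ≤ (n + k).choose n := by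
  classical
  have h1 : ((Finset.univ : Finset (Fin (n + 1))).finsuppAntidiag k).card ≤
      ((Finset.univ : Finset (Sym (Fin (n + 1)) k)).image
        (fun m : Sym (Fin (n + 1)) k => (m : Multiset (Fin (n + 1))))).card := by
    refine Finset.card_le_card_of_injOn (fun s => Finsupp.toMultiset s) ?_ ?_
    · intro s hs
      rw [Finset.mem_coe, Finset.mem_finsuppAntidiag] at hs
      have hcard : (Finsupp.toMultiset s).card = k := by
        rw [Finsupp.card_toMultiset, ← hs.1]
        exact (Finset.sum_subset (Finset.subset_univ _)
          fun i _ hi => Finsupp.notMem_support_iff.mp hi)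
      rw [Finset.mem_coe, Finset.mem_image]
      exact ⟨⟨Finsupp.toMultiset s, hcard⟩, Finset.mem_univ _, rfl⟩
    · intro s _ t _ hst
      have h := congrArg Multiset.toFinsupp hst
      simpa using h
  refine h1.trans (Finset.card_image_le.trans ?_)
  rw [Finset.card_univ, Sym.card_sym_eq_choose, Fintype.card_fin]
  have h2 : n + 1 + k - 1 = n + k := by omega
  rw [h2]
  exact (Nat.choose_symm_add (a := n) (b := k)).symm.le

variable [CharZero F]

/-- **Powers of affine forms span the polynomials of degree at most `d`** (EGOW 2018, end of the
proof of Thm. 4.2: "the set of all affine forms of degree `d` span the space of all polynomials of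
degree at most `d`"; characteristic zero). [cite: EfremenkoGargOliveiraWigderson2018, Thm. 4.2] -/
theorem mem_span_affinePowers (f : MvPolynomial (Fin n) F) (hf : f.totalDegree ≤ d) :
    f ∈ Submodule.span F (Set.range fun b : Fin (n + 1) → F =>
      (∑ v, C (b v) * Matrix.vecCons (1 : MvPolynomial (Fin n) F) (fun i => X i) v) ^ d) := by
  classical
  haveI : Infinite F := CharZero.infinite F
  obtain ⟨X', hX'⟩ : ∃ X' : Fin (n + 1) → MvPolynomial (Fin n) F,
      X' = Matrix.vecCons (1 : MvPolynomial (Fin n) F) (fun i => X i) := ⟨_, rfl⟩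
  rw [← hX']
  by_contra hfV
  obtain ⟨ψ, hψf, hψV⟩ := Submodule.exists_dual_map_eq_bot_of_notMem hfV inferInstance
  have hψ0 : ∀ b : Fin (n + 1) → F, ψ ((∑ v, C (b v) * X' v) ^ d) = 0 := fun b =>
    (Submodule.eq_bot_iff _).mp hψV _ (Submodule.mem_map_of_mem (Submodule.subset_span ⟨b, rfl⟩))
  -- the polynomial `G(y) = ψ((∑ y_v X'_v)^d)` in the variables `y`
  obtain ⟨G, hG⟩ : ∃ G : MvPolynomial (Fin (n + 1)) F,
      G = ∑ k ∈ (Finset.univ : Finset (Fin (n + 1))).piAntidiag d,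
        monomial (Finsupp.equivFunOnFinite.symm k)
          ((Nat.multinomial Finset.univ k : F) * ψ (∏ v, X' v ^ k v)) := ⟨_, rfl⟩
  have hGeval : ∀ b, eval b G = ψ ((∑ v, C (b v) * X' v) ^ d) := by
    intro b
    rw [hG, map_sum, sum_C_mul_pow_eq b X' d, map_sum]
    refine Finset.sum_congr rfl fun k _ => ?_
    rw [eval_monomial, Finsupp.prod_pow, map_smul, smul_eq_mul]
    simp only [Finsupp.coe_equivFunOnFinite_symm]
    ring
  have hG0 : G = 0 := MvPolynomial.funext fun b => by rw [hGeval, hψ0, map_zero]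
  -- its coefficients vanish
  have hcoeff : ∀ k ∈ (Finset.univ : Finset (Fin (n + 1))).piAntidiag d,
      ψ (∏ v, X' v ^ k v) = 0 := by
    intro k hk
    have h := congrArg (coeff (Finsupp.equivFunOnFinite.symm k)) hG0
    rw [coeff_zero, hG, coeff_sum, Finset.sum_eq_single k] at h
    · rw [coeff_monomial, if_pos rfl] at h
      exact (mul_eq_zero.mp h).resolve_left (Nat.cast_ne_zero.mpr (Nat.multinomial_pos _ _).ne')
    · intro k₂ _ hne
      rw [coeff_monomial, if_neg]
      exact fun h' => hne (Finsupp.equivFunOnFinite.symm.injective h')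
    · intro hk'
      exact absurd hk hk'
  -- hence ψ kills every monomial of degree ≤ d
  have hmon : ∀ e : Fin n →₀ ℕ, Finsupp.degree e ≤ d → ψ (monomial e 1) = 0 := by
    intro e he
    have hk : (Matrix.vecCons (d - Finsupp.degree e) e : Fin (n + 1) → ℕ) ∈
        (Finset.univ : Finset (Fin (n + 1))).piAntidiag d := by
      rw [Finset.mem_piAntidiag]
      refine ⟨?_, fun _ _ => Finset.mem_univ _⟩
      rw [Fin.sum_univ_succ]
      simp only [Matrix.cons_val_zero, Matrix.cons_val_succ]
      rw [← Finsupp.degree_eq_sum]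
      omega
    have h := hcoeff _ hk
    rw [Fin.prod_univ_succ] at h
    simp only [Matrix.cons_val_zero, Matrix.cons_val_succ, hX', one_pow, one_mul] at h
    rwa [← monomial_one_eq_prod_X_pow] at h
  apply hψf
  rw [f.as_sum, map_sum]
  refine Finset.sum_eq_zero fun e he => ?_
  have hdeg : Finsupp.degree e ≤ d := by
    have h := le_totalDegree he
    change Finsupp.degree e ≤ f.totalDegree at h
    exact h.trans hf
  rw [← mul_one (coeff e f), ← smul_eq_mul, ← smul_monomial, map_smul, hmon e hdeg, smul_zero]

variable {m : ℕ}

omit [CharZero F] in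
/-- **The generic affine power under `L`** (EGOW 2018, proof of Thm. 4.2:
`M(y_0, y) = L(ℓ(x)^d) = d! ∑ (e!/e_0!) y_0^{e_0} y^e M_e`): evaluation at `b` is `L(ℓ_b^d)`.
[cite: EfremenkoGargOliveiraWigderson2018, Thm. 4.2] -/
theorem waringPoly_map_eval (L : MvPolynomial (Fin n) F →ₗ[F] Matrix (Fin m) (Fin m) F)
    (b : Fin (n + 1) → F) :
    (∑ k ∈ (Finset.univ : Finset (Fin (n + 1))).piAntidiag d,
      (monomial (Finsupp.equivFunOnFinite.symm k) (Nat.multinomial Finset.univ k : F) :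
        MvPolynomial (Fin (n + 1)) F) •
        (L (∏ v, Matrix.vecCons (1 : MvPolynomial (Fin n) F) (fun i => X i) v ^ k v)).map C).map
        (eval b) =
      L ((∑ v, C (b v) * Matrix.vecCons (1 : MvPolynomial (Fin n) F) (fun i => X i) v) ^ d) := by
  classical
  rw [sum_C_mul_pow_eq, map_sum]
  refine Matrix.ext fun i j => ?_
  rw [Matrix.map_apply, Matrix.sum_apply, Matrix.sum_apply, map_sum]
  refine Finset.sum_congr rfl fun k _ => ?_
  rw [Matrix.smul_apply, Matrix.map_apply, smul_eq_mul, map_mul, eval_C, eval_monomial,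
    Finsupp.prod_pow, LinearMap.map_smul, Matrix.smul_apply, smul_eq_mul]
  simp only [Finsupp.coe_equivFunOnFinite_symm]

omit [CharZero F] in
/-- The entries of `M(y_0, y) = L(ℓ_y^d)` are homogeneous of degree `d` in `y` (EGOW 2018, proof of
Thm. 4.2). [cite: EfremenkoGargOliveiraWigderson2018, Thm. 4.2] -/
theorem waringPoly_isWeightedHomogeneous (L : MvPolynomial (Fin n) F →ₗ[F] Matrix (Fin m) (Fin m) F)
    (i j : Fin m) :
    IsWeightedHomogeneous (1 : Fin (n + 1) → ℕ)
      ((∑ k ∈ (Finset.univ : Finset (Fin (n + 1))).piAntidiag d,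
        (monomial (Finsupp.equivFunOnFinite.symm k) (Nat.multinomial Finset.univ k : F) :
          MvPolynomial (Fin (n + 1)) F) •
          (L (∏ v, Matrix.vecCons (1 : MvPolynomial (Fin n) F) (fun i => X i) v ^ k v)).map C) i j)
      d := by
  classical
  rw [Matrix.sum_apply]
  refine IsWeightedHomogeneous.sum _ _ _ fun k hk => ?_
  rw [Matrix.smul_apply, Matrix.map_apply, smul_eq_mul]
  have hw : Finsupp.weight (1 : Fin (n + 1) → ℕ) (Finsupp.equivFunOnFinite.symm k) = d := by
    rw [weight_one_eq_degree, Finsupp.degree_eq_sum]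
    simp only [Finsupp.coe_equivFunOnFinite_symm]
    exact (Finset.mem_piAntidiag.mp hk).1
  have h := (isWeightedHomogeneous_monomial (1 : Fin (n + 1) → ℕ) _ (Nat.multinomial Finset.univ k : F)
    hw).mul (isWeightedHomogeneous_C (1 : Fin (n + 1) → ℕ)
      (L (∏ v, Matrix.vecCons (1 : MvPolynomial (Fin n) F) (fun i => X i) v ^ k v) i j))
  rwa [add_zero] at h

end WaringInstance

/-! ## Theorem 4.2 and Theorem 1.2 -/

section Theorem42

/-- **EGOW 2018, Theorem 4.2, over any field of characteristic zero.** If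
`L : F[x_1..x_n] → Mat_m(F)` is linear and `rank L(ℓ^d) ≤ r` for every affine form `ℓ`, then
`rank L(f) ≤ r (d+1) · C(n + ⌊d/2⌋, n)` for every `f` of degree `≤ d`. [cite: EfremenkoGargOliveiraWigderson2018, Thm. 4.2] -/
theorem EGOW2018_thm42_of_charZero (F : Type) [Field F] [CharZero F] (m n d : ℕ)
    (L : MvPolynomial (Fin n) F →ₗ[F] Matrix (Fin m) (Fin m) F) (r : ℕ)
    (hr : ∀ (a₀ : F) (a : Fin n → F), (L (affineForm a₀ a ^ d)).rank ≤ r)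
    (f : MvPolynomial (Fin n) F) (hf : f.totalDegree ≤ d) :
    (L f).rank ≤ r * (d + 1) * Nat.choose (n + d / 2) n := by
  classical
  haveI : Infinite F := CharZero.infinite F
  -- the data of the engine
  let w : Fin (n + 1) → ℕ := 1
  let φ : ℕ →+ ℕ := AddMonoidHom.id ℕ
  have hφ : ∀ v, φ (w v) = 1 := fun v => rfl
  let Tset : Finset (ℕ × ℕ) := Finset.antidiagonal d
  have hT : ∀ x ∈ Tset, x.1 + x.2 = d := fun x hx => Finset.mem_antidiagonal.mp hx
  have hT' : ∀ s t : Fin (n + 1) →₀ ℕ, Finsupp.weight w s + Finsupp.weight w t = d →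
      (Finsupp.weight w s, Finsupp.weight w t) ∈ Tset := fun s t h => Finset.mem_antidiagonal.mpr h
  let S : ℕ → Finset (Fin (n + 1) →₀ ℕ) := fun k =>
    (Finset.univ : Finset (Fin (n + 1))).finsuppAntidiag k
  have hSmem : ∀ (k : ℕ) (s : Fin (n + 1) →₀ ℕ), Finsupp.weight w s = k → s ∈ S k := by
    intro k s hs
    rw [Finset.mem_finsuppAntidiag]
    refine ⟨?_, Finset.subset_univ _⟩
    rw [← hs, weight_one_eq_degree, Finsupp.degree_eq_sum]
  have hS : ∀ x ∈ Tset, ∀ s : Fin (n + 1) →₀ ℕ,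
      (Finsupp.weight w s = x.1 → s ∈ S x.1) ∧ (Finsupp.weight w s = x.2 → s ∈ S x.2) :=
    fun x _ s => ⟨hSmem _ s, hSmem _ s⟩
  let X' : Fin (n + 1) → MvPolynomial (Fin n) F := Matrix.vecCons 1 fun i => X i
  let P : Matrix (Fin m) (Fin m) (MvPolynomial (Fin (n + 1)) F) :=
    ∑ k ∈ (Finset.univ : Finset (Fin (n + 1))).piAntidiag d,
      (monomial (Finsupp.equivFunOnFinite.symm k) (Nat.multinomial Finset.univ k : F) :
        MvPolynomial (Fin (n + 1)) F) • (L (∏ v, X' v ^ k v)).map C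
  have hP : ∀ i j, IsWeightedHomogeneous w (P i j) d :=
    fun i j => waringPoly_isWeightedHomogeneous L i j
  have hPr : ∀ b : Fin (n + 1) → F, (P.map (eval b)).rank ≤ r := by
    intro b
    have h := hr (b 0) (fun i => b i.succ)
    rw [affineForm_eq_sum_vecCons] at h
    rw [waringPoly_map_eval]
    exact h
  -- the bound on the splittings
  have hcount : ∑ x ∈ Tset, min (S x.1).card (S x.2).card ≤ (d + 1) * Nat.choose (n + d / 2) n := by
    have h1 : ∀ x ∈ Tset, min (S x.1).card (S x.2).card ≤ Nat.choose (n + d / 2) n := by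
      intro x hx
      have hx' : x.1 + x.2 = d := Finset.mem_antidiagonal.mp hx
      by_cases hc : x.1 ≤ d / 2
      · exact (min_le_left _ _).trans ((card_finsuppAntidiag_univ_le x.1).trans
          (Nat.choose_le_choose n (by omega)))
      · exact (min_le_right _ _).trans ((card_finsuppAntidiag_univ_le x.2).trans
          (Nat.choose_le_choose n (by omega)))
    refine (Finset.sum_le_card_nsmul _ _ _ h1).trans ?_
    rw [smul_eq_mul, Finset.Nat.card_antidiagonal]
  -- L f as a combination of evaluations
  obtain ⟨c, hc⟩ := Finsupp.mem_span_range_iff_exists_finsupp.mp (mem_span_affinePowers f hf)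
  have hLf : L f = ∑ b ∈ c.support, c b • P.map (eval b) := by
    rw [← hc, Finsupp.sum, map_sum]
    refine Finset.sum_congr rfl fun b _ => ?_
    rw [LinearMap.map_smul, waringPoly_map_eval]
  rw [hLf]
  refine (rank_sum_smul_eval_le_of_weighted w φ hφ d Tset hT hT' S hS P hP r hPr
    c.support id c).trans ?_
  rw [mul_assoc]
  exact Nat.mul_le_mul_left r hcount

/-- **EGOW 2018, Theorem 4.2** (Waring rank upper bounds) — discharge of the named fact
`EGOW2018_thm42`. [cite: EfremenkoGargOliveiraWigderson2018, Thm. 4.2] -/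
theorem EGOW2018_thm42_holds : EGOW2018_thm42 := by
  intro F _ _ _ m n d _ _ L r hr f hf
  exact EGOW2018_thm42_of_charZero F m n d L r hr f hf

/-- **EGOW 2018, Theorem 1.2 / Corollary 4.3** (barrier for Waring rank:
`c(Δ₀^W) ≤ (d+1) · C(n+⌊d/2⌋, n)`) — discharge of the named fact `EGOW2018_thm12`.
[cite: EfremenkoGargOliveiraWigderson2018, Thm. 1.2] -/
theorem EGOW2018_thm12_holds : EGOW2018_thm12 :=
  EGOW2018_thm42_holds.thm12

end Theorem42

end Literature.Computability.AlgebraicComplexity
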